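import Mathlib.Algebra.BigOperators.Fin
import Literature.Computability.AlgebraicComplexity.LaserMethodRestriction
import HarnessLib

/-!
# SaturationLadder — BCS Prop. 15.30 with LINEAR block-supported component maps

Route `SaturationLadder` (sub-problem `MatrixMultiplication`), support for the aside
`TwinSaturation` (stmt-MatrixMultiplication-30539); first of three files
(`…LinearRestriction`, `…TwinComponents`, `…TwinRestriction`).  The tree's
`tensorRestrictsTo_kroneckerPow_matMulDirectSum_of_free` (BCS 1997, Prop. 15.30 with the proof of
Thm. 15.41) identifies the `D`-components of `t` with matrix tensors along INDEX EMBEDDINGS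
`eI, eJ, eL` (coordinate sub-tensors).  For the twin Coppersmith–Winograd tensor `TW_b`
(`Theorems/SaturationLadderTwinCW.lean`) the quadratic component
`∑ᵢ (x′ᵢ y′ᵢ z_{s₁} + x″ᵢ y″ᵢ z_{s₂})` is NOT a matrix tensor on coordinates, but it RESTRICTS to
`⟨b, 2, 1⟩` through the linear identification `x′ᵢ, x″ᵢ ↦ xᵢ` — a genuine linear map inside the
block.  This file proves the general form of Prop. 15.30 needed for that: the components are
identified with matrix tensors through arbitrary MATRICES supported in their blocks
(`MI s : (Fin k × Fin n) → ι → K` with `MI s u a ≠ 0 ⇒ bI a = s.1`, etc., and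
`∑_{a,b,c} MI·MJ·ML·t = ⟨k s, m s, n s⟩` entrywise), and then, for a free diagonal `Δ` of
`S^N`-supported label triples, `t^{⊗N}` restricts to `⊕_{δ∈Δ} ⟨∏k, ∏m, ∏n⟩`.  The restriction
matrices of the power are the digitwise products of the component matrices; on the diagonal
blocks the sum factorises position by position (`Fintype.prod_sum`) into the component
identities, off the diagonal every position's factor being non-zero would put the label triple
into `S^N`, which freeness forbids — the same two steps as the coordinate version, which is the
special case of 0/1 matrices of injections.

Main results: `laserMat₁₂₃` (the restriction matrices), `sum_laserMat_kroneckerPow_eq`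
(entrywise identity), `tensorRestrictsTo_kroneckerPow_matMulDirectSum_of_free_linear`.

References: P. Bürgisser, M. Clausen, M. A. Shokrollahi, *Algebraic Complexity Theory* (1997),
§15.6 Prop. 15.30, Thm. 15.41 (proof p. 381) [BurgisserClausenShokrollahi1997].
-/

noncomputable section

open scoped BigOperators
open Finset Literature.Computability.AlgebraicComplexity

namespace Summit.MatrixMultiplication.MatrixMultiplication.Theorems.SaturationLadderLinearRestriction

universe u

variable {K : Type u} [CommSemiring K]
variable {ι κ μ : Type*} {I J L : Type*}

/-- Restriction matrix of the power on the first factor: row `u` (a matrix index of the block with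
label sequence `s`), column the word `x`; entry `∏_ρ MI s_ρ (digits of u at ρ) (x ρ)`.
[cite: BurgisserClausenShokrollahi1997, Thm. 15.41 (proof, p. 381)] -/
def laserMat₁ (k n : I × J × L → ℕ) (MI : ∀ s : I × J × L, Fin (k s) × Fin (n s) → ι → K) {N : ℕ}
    (s : Fin N → I × J × L) (u : Fin (∏ ρ, k (s ρ)) × Fin (∏ ρ, n (s ρ))) (x : Fin N → ι) : K :=
  ∏ ρ, MI (s ρ) (finPiFinEquiv.symm u.1 ρ, finPiFinEquiv.symm u.2 ρ) (x ρ)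

/-- Restriction matrix of the power on the second factor. [cite: BurgisserClausenShokrollahi1997, Thm. 15.41 (proof, p. 381)] -/
def laserMat₂ (k m : I × J × L → ℕ) (MJ : ∀ s : I × J × L, Fin (k s) × Fin (m s) → κ → K) {N : ℕ}
    (s : Fin N → I × J × L) (v : Fin (∏ ρ, k (s ρ)) × Fin (∏ ρ, m (s ρ))) (y : Fin N → κ) : K :=
  ∏ ρ, MJ (s ρ) (finPiFinEquiv.symm v.1 ρ, finPiFinEquiv.symm v.2 ρ) (y ρ)

/-- Restriction matrix of the power on the third factor. [cite: BurgisserClausenShokrollahi1997, Thm. 15.41 (proof, p. 381)] -/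
def laserMat₃ (m n : I × J × L → ℕ) (ML : ∀ s : I × J × L, Fin (m s) × Fin (n s) → μ → K) {N : ℕ}
    (s : Fin N → I × J × L) (w : Fin (∏ ρ, m (s ρ)) × Fin (∏ ρ, n (s ρ))) (z : Fin N → μ) : K :=
  ∏ ρ, ML (s ρ) (finPiFinEquiv.symm w.1 ρ, finPiFinEquiv.symm w.2 ρ) (z ρ)

/-- Sum–product interchange for three word variables:
`∑_{x,y,z} ∏_ρ F ρ (x ρ) (y ρ) (z ρ) = ∏_ρ ∑_{a,b,c} F ρ a b c`. [folklore] -/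
theorem sum_sum_sum_prod_eq [Fintype ι] [Fintype κ] [Fintype μ] {N : ℕ}
    (F : Fin N → ι → κ → μ → K) :
    ∑ x : Fin N → ι, ∑ y : Fin N → κ, ∑ z : Fin N → μ, ∏ ρ, F ρ (x ρ) (y ρ) (z ρ) =
      ∏ ρ, ∑ a, ∑ b, ∑ c, F ρ a b c := by
  classical
  rw [Fintype.prod_sum]
  refine Finset.sum_congr rfl fun x _ => ?_
  rw [Fintype.prod_sum]
  refine Finset.sum_congr rfl fun y _ => ?_
  rw [Fintype.prod_sum]

variable [Fintype ι] [Fintype κ] [Fintype μ]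

/-- **The blocks of a free diagonal, entrywise, for linear component maps** (BCS Prop. 15.30 with the
proof of Thm. 15.41, p. 381): for a free diagonal `d : Fin p → Δ` of `S^N`-supported label triples,
`⊕_i ⟨∏k, ∏m, ∏n⟩(labels of d i)` equals `t^{⊗N}` composed with the matrices `laserMat₁₂₃`.
[cite: BurgisserClausenShokrollahi1997, Prop. 15.30 and Thm. 15.41 (proof, p. 381)] -/
theorem sum_laserMat_kroneckerPow_eq (t : ι → κ → μ → K) (bI : ι → I) (bJ : κ → J)
    (bL : μ → L) (S : Finset (I × J × L)) (hS : ∀ a b c, t a b c ≠ 0 → (bI a, bJ b, bL c) ∈ S)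
    (k m n : I × J × L → ℕ) (MI : ∀ s, Fin (k s) × Fin (n s) → ι → K)
    (MJ : ∀ s, Fin (k s) × Fin (m s) → κ → K) (ML : ∀ s, Fin (m s) × Fin (n s) → μ → K)
    (hMI : ∀ s ∈ S, ∀ u a, MI s u a ≠ 0 → bI a = s.1)
    (hMJ : ∀ s ∈ S, ∀ v b, MJ s v b ≠ 0 → bJ b = s.2.1)
    (hML : ∀ s ∈ S, ∀ w c, ML s w c ≠ 0 → bL c = s.2.2)
    (hmat : ∀ s ∈ S, ∀ u v w, ∑ a, ∑ b, ∑ c, MI s u a * MJ s v b * ML s w c * t a b c =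
      matMulTensor K (k s) (m s) (n s) u v w)
    {N p : ℕ} (d : Fin p → (Fin N → I) × (Fin N → J) × (Fin N → L))
    (hdS : ∀ i ρ, labelSeq (d i) ρ ∈ S)
    (hfree : ∀ i i' i'', (∀ ρ, ((d i).1 ρ, (d i').2.1 ρ, (d i'').2.2 ρ) ∈ S) → i = i' ∧ i' = i'')
    (a : Σ i : Fin p, Fin (∏ ρ, k (labelSeq (d i) ρ)) × Fin (∏ ρ, n (labelSeq (d i) ρ)))
    (b : Σ i : Fin p, Fin (∏ ρ, k (labelSeq (d i) ρ)) × Fin (∏ ρ, m (labelSeq (d i) ρ)))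
    (c : Σ i : Fin p, Fin (∏ ρ, m (labelSeq (d i) ρ)) × Fin (∏ ρ, n (labelSeq (d i) ρ))) :
    matMulDirectSum K (fun i => ∏ ρ, k (labelSeq (d i) ρ)) (fun i => ∏ ρ, m (labelSeq (d i) ρ))
        (fun i => ∏ ρ, n (labelSeq (d i) ρ)) a b c =
      ∑ x : Fin N → ι, ∑ y : Fin N → κ, ∑ z : Fin N → μ,
        laserMat₁ k n MI (labelSeq (d a.1)) a.2 x * laserMat₂ k m MJ (labelSeq (d b.1)) b.2 y *
          laserMat₃ m n ML (labelSeq (d c.1)) c.2 z * kroneckerPow t N x y z := by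
  classical
  obtain ⟨i, u⟩ := a
  obtain ⟨i', v⟩ := b
  obtain ⟨i'', w⟩ := c
  -- the right-hand side factorises position by position
  have hfact : (∑ x : Fin N → ι, ∑ y : Fin N → κ, ∑ z : Fin N → μ,
        laserMat₁ k n MI (labelSeq (d i)) u x * laserMat₂ k m MJ (labelSeq (d i')) v y *
          laserMat₃ m n ML (labelSeq (d i'')) w z * kroneckerPow t N x y z) =
      ∏ ρ, ∑ a, ∑ b, ∑ c,
        MI (labelSeq (d i) ρ) (finPiFinEquiv.symm u.1 ρ, finPiFinEquiv.symm u.2 ρ) a *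
          MJ (labelSeq (d i') ρ) (finPiFinEquiv.symm v.1 ρ, finPiFinEquiv.symm v.2 ρ) b *
          ML (labelSeq (d i'') ρ) (finPiFinEquiv.symm w.1 ρ, finPiFinEquiv.symm w.2 ρ) c *
          t a b c := by
    rw [← sum_sum_sum_prod_eq]
    refine Finset.sum_congr rfl fun x _ => Finset.sum_congr rfl fun y _ =>
      Finset.sum_congr rfl fun z _ => ?_
    simp only [laserMat₁, laserMat₂, laserMat₃, kroneckerPow_apply, ← Finset.prod_mul_distrib]
  simp only at hfact ⊢
  rw [hfact]
  by_cases hdiag : i = i' ∧ i' = i''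
  · -- a diagonal block: the component identity, digit by digit
    obtain ⟨rfl, rfl⟩ := hdiag
    rw [matMulDirectSum_block]
    rw [Finset.prod_congr rfl fun ρ _ => hmat _ (hdS i ρ) _ _ _]
    simp only [matMulTensor, Fintype.prod_boole]
    have hiff : (u.1 = v.1 ∧ v.2 = w.1 ∧ u.2 = w.2) ↔
        ∀ ρ, finPiFinEquiv.symm u.1 ρ = finPiFinEquiv.symm v.1 ρ ∧
          finPiFinEquiv.symm v.2 ρ = finPiFinEquiv.symm w.1 ρ ∧
          finPiFinEquiv.symm u.2 ρ = finPiFinEquiv.symm w.2 ρ := by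
      rw [← finPiFinEquiv.symm.injective.eq_iff (a := u.1), ← finPiFinEquiv.symm.injective.eq_iff
        (a := v.2), ← finPiFinEquiv.symm.injective.eq_iff (a := u.2)]
      simp only [funext_iff]
      exact ⟨fun h ρ => ⟨h.1 ρ, h.2.1 ρ, h.2.2 ρ⟩,
        fun h => ⟨fun ρ => (h ρ).1, fun ρ => (h ρ).2.1, fun ρ => (h ρ).2.2⟩⟩
    by_cases h : u.1 = v.1 ∧ v.2 = w.1 ∧ u.2 = w.2
    · rw [if_pos h, if_pos (hiff.1 h)]
    · rw [if_neg h, if_neg (mt hiff.2 h)]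
  · -- off the diagonal both sides vanish
    rw [matMulDirectSum_of_ne _ _ _ _ (not_and_or.mp hdiag)]
    symm
    by_contra hne
    refine hdiag (hfree i i' i'' fun ρ => ?_)
    -- the `ρ`-th factor is non-zero, so some summand is
    have hρ := fun h0 => hne (Finset.prod_eq_zero (Finset.mem_univ ρ) h0)
    obtain ⟨a, -, ha⟩ := Finset.exists_ne_zero_of_sum_ne_zero hρ
    obtain ⟨b, -, hb⟩ := Finset.exists_ne_zero_of_sum_ne_zero ha
    obtain ⟨c, -, hc⟩ := Finset.exists_ne_zero_of_sum_ne_zero hb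
    have h1 : MI (labelSeq (d i) ρ) (finPiFinEquiv.symm u.1 ρ, finPiFinEquiv.symm u.2 ρ) a ≠ 0 :=
      fun h0 => hc (by rw [h0]; simp)
    have h2 : MJ (labelSeq (d i') ρ) (finPiFinEquiv.symm v.1 ρ, finPiFinEquiv.symm v.2 ρ) b ≠ 0 :=
      fun h0 => hc (by rw [h0]; simp)
    have h3 : ML (labelSeq (d i'') ρ) (finPiFinEquiv.symm w.1 ρ, finPiFinEquiv.symm w.2 ρ) c ≠ 0 :=
      fun h0 => hc (by rw [h0]; simp)
    have h4 : t a b c ≠ 0 := fun h0 => hc (by rw [h0]; simp)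
    have hmem := hS _ _ _ h4
    rw [hMI _ (hdS i ρ) _ _ h1, hMJ _ (hdS i' ρ) _ _ h2, hML _ (hdS i'' ρ) _ _ h3] at hmem
    simpa [labelSeq] using hmem

/-- **`⊕_{δ ∈ Δ} ⟨∏k, ∏m, ∏n⟩ ≤ t^{⊗N}` for a free diagonal `Δ`, linear component maps**
(BCS Prop. 15.30 / Thm. 15.41, hypothesis (2) "all `D`-components are isomorphic to matrix tensors"
in the general form: each component RESTRICTS to `⟨k s, m s, n s⟩` through matrices supported in
its block). [cite: BurgisserClausenShokrollahi1997, Prop. 15.30 and Thm. 15.41 (proof, p. 381)] -/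
theorem tensorRestrictsTo_kroneckerPow_matMulDirectSum_of_free_linear [DecidableEq ι]
    [DecidableEq κ] [DecidableEq μ] (t : ι → κ → μ → K) (bI : ι → I)
    (bJ : κ → J) (bL : μ → L) (S : Finset (I × J × L))
    (hS : ∀ a b c, t a b c ≠ 0 → (bI a, bJ b, bL c) ∈ S)
    (k m n : I × J × L → ℕ) (MI : ∀ s, Fin (k s) × Fin (n s) → ι → K)
    (MJ : ∀ s, Fin (k s) × Fin (m s) → κ → K) (ML : ∀ s, Fin (m s) × Fin (n s) → μ → K)
    (hMI : ∀ s ∈ S, ∀ u a, MI s u a ≠ 0 → bI a = s.1)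
    (hMJ : ∀ s ∈ S, ∀ v b, MJ s v b ≠ 0 → bJ b = s.2.1)
    (hML : ∀ s ∈ S, ∀ w c, ML s w c ≠ 0 → bL c = s.2.2)
    (hmat : ∀ s ∈ S, ∀ u v w, ∑ a, ∑ b, ∑ c, MI s u a * MJ s v b * ML s w c * t a b c =
      matMulTensor K (k s) (m s) (n s) u v w)
    {N p : ℕ} (d : Fin p → (Fin N → I) × (Fin N → J) × (Fin N → L))
    (hdS : ∀ i ρ, labelSeq (d i) ρ ∈ S)
    (hfree : ∀ i i' i'', (∀ ρ, ((d i).1 ρ, (d i').2.1 ρ, (d i'').2.2 ρ) ∈ S) → i = i' ∧ i' = i'') :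
    TensorRestrictsTo (kroneckerPow t N)
      (matMulDirectSum K (fun i => ∏ ρ, k (labelSeq (d i) ρ)) (fun i => ∏ ρ, m (labelSeq (d i) ρ))
        (fun i => ∏ ρ, n (labelSeq (d i) ρ))) :=
  ⟨fun a x => laserMat₁ k n MI (labelSeq (d a.1)) a.2 x,
    fun b y => laserMat₂ k m MJ (labelSeq (d b.1)) b.2 y,
    fun c z => laserMat₃ m n ML (labelSeq (d c.1)) c.2 z,
    fun a b c => sum_laserMat_kroneckerPow_eq t bI bJ bL S hS k m n MI MJ ML hMI hMJ hML hmat d hdS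
      hfree a b c⟩

end Summit.MatrixMultiplication.MatrixMultiplication.Theorems.SaturationLadderLinearRestriction
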